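import Mathlib
import HarnessLib

/-!
# `HeteroclinicTriggerChain` — crux `TriggerChainFrontStep` (item stmt-NavierStokesRegularity-22785):
  EXPONENTIAL CAPTURE of the forced arc (sharp transfer time, segment form)

Refinement of the capture lemma of `…ForcedArcWithin` (which gives a capture time LINEAR in the inverse
incompleteness). For the forced arc `D′ = −2e·u² + f₁`, `u′ = e·D·u + f₂` (`|f₁| ≤ φ`) the radius
`Q = D² + 2u²` is almost conserved, so `D′ = −e(Q − D²) + f₁ ≤ −e(ρ₋ − D)(ρ₋ + D) + φ` whenever
`Q ≥ ρ₋²`; once the carrier surplus is non-positive (`D ≤ 0`) the distance `z = D + ρ₋` to complete transfer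
therefore decays exponentially down to the forcing floor:

  `D(t) + ρ₋ ≤ max(D(s) + ρ₋, 0)·e^{−eρ₋(t−s)} + φ/(eρ₋)`   (`heteroclinicTriggerChain_forcedArcOn_exp_capture`),

i.e. the incompleteness `δ` is reached after `log(ρ/δ)/(eρ₋) + O(1)` — the logistic rate of the exact arc —
which is what the lifespan pinch of the certificate needs (capture in `O(log(1/δ))`, not `O(1/δ)`).
One-sided derivatives on the window (the regularity of `TaoCascade.PseudoFlowOn`).

HONEST FRAMING: elementary real analysis of a planar ODE with bounded forcing on a segment; helper lemma
for the crux (no stub credit); nothing here is a statement about the Navier–Stokes equations; no summit,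
rung or crux is proved by this file.
-/

noncomputable section

set_option linter.dupNamespace false

open Real Set

namespace Summit.NavierStokesRegularity.NavierStokesRegularity.Theorems

/-- **Exponential capture of the forced arc.** On `[s,T]` (derivatives within the segment) let
`D′ = −2e·u² + f₁` with `e > 0`, `|f₁| ≤ φ`, `D ≤ 0`, and let `ρ₋ > 0` with `ρ₋² ≤ D² + 2u²` (the radius
stays above `ρ₋`). Then for `t ∈ [s,T]`:
`D(t) + ρ₋ ≤ max (D(s) + ρ₋) 0 · e^{−eρ₋(t−s)} + φ/(eρ₋)`. [folklore] -/
theorem heteroclinicTriggerChain_forcedArcOn_exp_capture {e φ ρm s T : ℝ} {D u f₁ : ℝ → ℝ}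
    (he : 0 < e) (hρ : 0 < ρm)
    (hD : ∀ t ∈ Icc s T, HasDerivWithinAt D (-(2 * e * u t ^ 2) + f₁ t) (Icc s T) t)
    (hf₁ : ∀ t ∈ Icc s T, |f₁ t| ≤ φ) (hD0 : ∀ t ∈ Icc s T, D t ≤ 0)
    (hQ : ∀ t ∈ Icc s T, ρm ^ 2 ≤ D t ^ 2 + 2 * u t ^ 2) :
    ∀ t ∈ Icc s T, D t + ρm ≤ max (D s + ρm) 0 * Real.exp (-(e * ρm * (t - s))) + φ / (e * ρm) := by
  intro t ht
  rcases lt_or_ge T s with hTs | hsT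
  · exact absurd (ht.1.trans ht.2) (not_le.2 hTs)
  have hφ : 0 ≤ φ := (abs_nonneg _).trans (hf₁ s ⟨le_rfl, hsT⟩)
  have hK : 0 < e * ρm := mul_pos he hρ
  have hDc : ContinuousOn D (Icc s T) := fun r hr => (hD r hr).continuousWithinAt
  have hD' : ∀ r ∈ Ico s T, HasDerivWithinAt D (-(2 * e * u r ^ 2) + f₁ r) (Ici r) r := fun r hr =>
    (hD r (Ico_subset_Icc_self hr)).mono_of_mem_nhdsWithin (Icc_mem_nhdsGE_of_mem hr)
  -- z = D + ρ₋ and its differential inequality z' ≤ -eρ₋ z + φ (when z ≥ 0)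
  set z0 : ℝ := max (D s + ρm) 0 with hz0
  have hz0nn : 0 ≤ z0 := le_max_right _ _
  -- fences B_ε = (z0 + ε) e^{-K(t-s)} + ((φ+ε)/K)(1 - e^{-K(t-s)})
  have hmain : ∀ ε : ℝ, 0 < ε → D t + ρm ≤
      (z0 + ε) * Real.exp (-(e * ρm * (t - s))) +
        (φ + ε) / (e * ρm) * (1 - Real.exp (-(e * ρm * (t - s)))) := by
    intro ε hε
    have hBd : ∀ r, HasDerivAt (fun r => (z0 + ε) * Real.exp (-(e * ρm * (r - s))) +
        (φ + ε) / (e * ρm) * (1 - Real.exp (-(e * ρm * (r - s)))))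
        (-(e * ρm) * ((z0 + ε) * Real.exp (-(e * ρm * (r - s))) +
          (φ + ε) / (e * ρm) * (1 - Real.exp (-(e * ρm * (r - s))))) + (φ + ε)) r := by
      intro r
      have hE : HasDerivAt (fun r => Real.exp (-(e * ρm * (r - s))))
          (Real.exp (-(e * ρm * (r - s))) * (-(e * ρm))) r := by
        have h := (((hasDerivAt_id r).sub_const s).const_mul (-(e * ρm))).exp
        convert h using 1
        · funext y; congr 1; simp only [id]; ring
        · simp only [id]; ring
      have h := (hE.const_mul (z0 + ε)).add ((hE.const_sub 1).const_mul ((φ + ε) / (e * ρm)))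
      refine h.congr_deriv ?_
      field_simp
      ring
    have h := image_le_of_deriv_right_lt_deriv_boundary (f := fun r => D r + ρm) (a := s) (b := T)
      (B := fun r => (z0 + ε) * Real.exp (-(e * ρm * (r - s))) +
        (φ + ε) / (e * ρm) * (1 - Real.exp (-(e * ρm * (r - s)))))
      (hDc.add continuousOn_const) (fun r hr => (hD' r hr).add_const ρm)
      (by
        simp only [sub_self, mul_zero, neg_zero, Real.exp_zero, mul_one, sub_self, mul_zero, add_zero]
        linarith [le_max_left (D s + ρm) 0])
      hBd
      (fun r hr hcontact => by
        have hr' := Ico_subset_Icc_self hr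
        set Er : ℝ := Real.exp (-(e * ρm * (r - s))) with hEr
        have hEpos : 0 < Er := Real.exp_pos _
        have hEle : Er ≤ 1 := by
          rw [hEr, Real.exp_le_one_iff]; nlinarith [hr.1, hK]
        set B : ℝ := (z0 + ε) * Er + (φ + ε) / (e * ρm) * (1 - Er) with hB
        have hBpos : 0 < B := by
          have h1 : 0 < (z0 + ε) * Er := mul_pos (by linarith) hEpos
          have h2 : 0 ≤ (φ + ε) / (e * ρm) * (1 - Er) :=
            mul_nonneg (div_nonneg (by linarith) hK.le) (by linarith)
          linarith
        -- at contact z = B > 0, so D = B - ρ₋ and z' ≤ -e(ρ₋ - D) z + φ ≤ -eρ₋ B + φ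
        have hz : D r + ρm = B := hcontact
        have hDr : D r = B - ρm := by linarith
        have hq := hQ r hr'
        have hu2 : ρm * B ≤ 2 * u r ^ 2 := by
          -- 2u² ≥ ρ₋² − D² = (ρ₋ − D)(ρ₋ + D) = (2ρ₋ − B)·B ≥ ρ₋ B  (B ≤ ρ₋ since D ≤ 0)
          have hBle : B ≤ ρm := by linarith [hD0 r hr']
          nlinarith
        have hf := (abs_le.1 (hf₁ r hr')).2
        show -(2 * e * u r ^ 2) + f₁ r < -(e * ρm) * B + (φ + ε)
        nlinarith)
      ht
    exact h
  -- ε → 0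
  set E : ℝ := Real.exp (-(e * ρm * (t - s))) with hE
  have hEle : E ≤ 1 := by rw [hE, Real.exp_le_one_iff]; nlinarith [ht.1, hK]
  have hEpos : 0 < E := Real.exp_pos _
  have hlim : D t + ρm ≤ z0 * E + φ / (e * ρm) * (1 - E) := by
    refine le_of_forall_pos_le_add fun δ hδ => ?_
    -- B_ε = z0 E + φ/K (1-E) + ε (E + (1-E)/K)
    have hcoef : 0 < E + (1 - E) / (e * ρm) := by
      have : 0 ≤ (1 - E) / (e * ρm) := div_nonneg (by linarith) hK.le
      linarith
    have h := hmain (δ / (E + (1 - E) / (e * ρm))) (div_pos hδ hcoef)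
    have key : δ / (E + (1 - E) / (e * ρm)) * (E + (1 - E) / (e * ρm)) = δ :=
      div_mul_cancel₀ _ hcoef.ne'
    calc D t + ρm ≤ (z0 + δ / (E + (1 - E) / (e * ρm))) * E +
          (φ + δ / (E + (1 - E) / (e * ρm))) / (e * ρm) * (1 - E) := h
      _ = z0 * E + φ / (e * ρm) * (1 - E) +
          δ / (E + (1 - E) / (e * ρm)) * (E + (1 - E) / (e * ρm)) := by
            field_simp
            ring
      _ = z0 * E + φ / (e * ρm) * (1 - E) + δ := by rw [key]
  have hlast : φ / (e * ρm) * (1 - E) ≤ φ / (e * ρm) := by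
    have : 0 ≤ φ / (e * ρm) := div_nonneg hφ hK.le
    nlinarith
  linarith

end Summit.NavierStokesRegularity.NavierStokesRegularity.Theorems

end
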